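import Mathlib
import HarnessLib
import Literature.Analysis.FluidPDE.SpaceTimeCalculus
import Summits.NavierStokesRegularity.NavierStokesRegularity.Theorems.PoloidalWindowDoorPoloidalWindowRigidityZShockWaveLocalEnergy

/-!
# Crux K2 `PoloidalWindowRigidity` (stmt-NavierStokesRegularity-19708), line `z_shock` — R3 infrastructure: the LOCAL ENERGY
# INEQUALITY WITH HYPOTHESES ON THE SOLID CONE ONLY (balance law / equation assumed on an open space–time set, not globally)

`--supports stmt-NavierStokesRegularity-19708 --as helper` (leafhand-ns-poloidalwindowdoor-3 g6, cell decomp-ns, 2026-08-31).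
**No stub and no summit is closed by this file; Navier–Stokes regularity is NOT proved here (rung 0).**

WHY THIS FILE.  Hands 3-g4/3-g5 landed the energy method for the autonomous height-evolution `w_ss = div(γ(w)∇w)` of rung R3
(`…ZShockLocalEnergy`: abstract balance law `∂ₛe + div f = σ` with dominated flux; `…ZShockWaveLocalEnergy`: the instantiation on the
equation), with the balance law / the equation assumed at EVERY point of `ℝ × ℝⁿ`.  On the deciding stub's data the equation is only
available on an OPEN SUBSET of the slice: `…ZShockHeightEvolution.heightEvolution_of_class_autonomy` gives it on each connected
component `Ω` of the non-degenerate set `{∇ₕv₂ ≠ 0}` (where the slope function lives), and hyperbolicity / the bounds on `γ(w)` hold on the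
window, not globally.  Hand 3-g5 therefore listed «localised part 2 (balance law on an open space–time set ⊇ solid cone)» as a remaining
packaging item for an R3 lead (exit report 2026-08-31T15:11Z).  This file is that item.  The proofs of parts 2–3 use every hypothesis
only under the integral against the moving cutoff `χ_a(⟨y⟩ + cs)` or its derivative, both of which vanish off the solid backward cone;
so the same statements hold with the balance law, positivity, flux dominance and source bound assumed ONLY on the truncated solid cone
`{(s, y) : t₀ ≤ s ≤ t, ⟨y⟩ + cs ≤ a + 1}` (`⟨y⟩ = √(1+|y|²)`), the fields themselves staying globally smooth (as they are on the stub's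
data: the slice is entire real-analytic):

* `hasDerivAt_coneEnergy_local`, `deriv_coneEnergy_le_local`, `coneEnergy_le_exp_mul_local` (Grönwall on `[t₀, t]` only),
  `setIntegral_closedBall_le_exp_mul_local` — the abstract part with cone-local hypotheses, the last one phrased with the user-friendly
  region `‖y‖ ≤ √(1+ρ²) + c(t − s) + 1` at height `s ∈ [t₀, t]`;
* the wave half (pointwise balance `waveEnergy_balance_at`, `waveEnergy_closedBall_le_exp_mul_local`, `static_of_static_data_local`
  for `w_ss = div(γ(w)∇w)` with the equation and the bounds on `γ` assumed only on the cone) is the companion file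
  `…ZShockWaveLocalEnergyLocal` (≤ 400-line rule).

Combined with the slice-typing dictionary (`…ZShockSliceTyping.slice_wave_pde_field`, this hand) the energy files then apply to the
stub's objects on every solid cone inside a strictly hyperbolic sub-region of a non-degenerate component `Ω`.  HONEST: bookkeeping-grade;
the quantitative inequality proves no rigidity (the cubic source is the THICK term).  presearch: textbook energy method (Evans §2.4.3; [corpus:book:alinhac2009
pp.44–46]); tree parts 1–3 cited above. [folklore]
-/

noncomputable section

namespace Summit.NavierStokesRegularity.NavierStokesRegularity.Theorems.PoloidalWindowDoorPoloidalWindowRigidityZShockLocalEnergyLocal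

-- the problem directory repeats the summit name (`NavierStokesRegularity/NavierStokesRegularity`)
set_option linter.dupNamespace false

open MeasureTheory Set Filter Topology Function Metric
open scoped ContDiff
open Literature.Analysis.FluidPDE
open Summit.NavierStokesRegularity.NavierStokesRegularity.Theorems.PoloidalWindowDoorPoloidalWindowRigidityZShockLocalEnergyCutoff
open Summit.NavierStokesRegularity.NavierStokesRegularity.Theorems.PoloidalWindowDoorPoloidalWindowRigidityZShockLocalEnergy
open Summit.NavierStokesRegularity.NavierStokesRegularity.Theorems.PoloidalWindowDoorPoloidalWindowRigidityZShockWaveLocalEnergy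

/-! ### The abstract balance law with cone-local hypotheses -/

section ConeEnergy

variable {n : ℕ} {e σ : ℝ → EuclideanSpace ℝ (Fin n) → ℝ} {f : Fin n → ℝ → EuclideanSpace ℝ (Fin n) → ℝ}

/-- Off the solid cone (`a + 1 < ⟨y⟩ + cs`) the moving cutoff vanishes. [folklore] -/
theorem cutoff_eq_zero_of_lt {a c s : ℝ} {y : EuclideanSpace ℝ (Fin n)} (hy : a + 1 < √(1 + ‖y‖ ^ 2) + c * s) :
    Real.smoothTransition (a + 1 - (√(1 + ‖y‖ ^ 2) + c * s)) = 0 :=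
  profile_eq_zero hy.le

/-- Off the solid cone (`a + 1 < ⟨y⟩ + cs`) the derivative factor of the moving cutoff vanishes. [folklore] -/
theorem deriv_cutoff_eq_zero_of_lt {a c s : ℝ} {y : EuclideanSpace ℝ (Fin n)} (hy : a + 1 < √(1 + ‖y‖ ^ 2) + c * s) :
    deriv (fun v : ℝ => Real.smoothTransition (a + 1 - v)) (√(1 + ‖y‖ ^ 2) + c * s) = 0 :=
  deriv_profile_eq_zero hy

/-- **Height derivative of the cone energy, balance law assumed on the cone slice only.**  As
`…ZShockLocalEnergy.hasDerivAt_coneEnergy`, but the balance law `∂ₛe + Σᵢ ∂ᵢfᵢ = σ` is required only at the points `(s, y)` with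
`⟨y⟩ + cs ≤ a + 1` (the slice at height `s` of the solid cone carrying the cutoff). [folklore] -/
theorem hasDerivAt_coneEnergy_local (he : ContDiff ℝ ∞ (uncurry e)) (hf : ∀ i, ContDiff ℝ ∞ (uncurry (f i)))
    (hσ : ContDiff ℝ ∞ (uncurry σ)) (a c s : ℝ)
    (hbal : ∀ y : EuclideanSpace ℝ (Fin n), √(1 + ‖y‖ ^ 2) + c * s ≤ a + 1 →
      deriv (fun s' => e s' y) s + ∑ i, fderiv ℝ (f i s) y (EuclideanSpace.single i 1) = σ s y) :
    HasDerivAt (fun s' => ∫ y : EuclideanSpace ℝ (Fin n),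
        Real.smoothTransition (a + 1 - (√(1 + ‖y‖ ^ 2) + c * s')) * e s' y)
      ((∫ y : EuclideanSpace ℝ (Fin n),
          deriv (fun v : ℝ => Real.smoothTransition (a + 1 - v)) (√(1 + ‖y‖ ^ 2) + c * s) / √(1 + ‖y‖ ^ 2) *
            (c * √(1 + ‖y‖ ^ 2) * e s y + ∑ i, y i * f i s y)) +
        ∫ y : EuclideanSpace ℝ (Fin n), Real.smoothTransition (a + 1 - (√(1 + ‖y‖ ^ 2) + c * s)) * σ s y) s := by
  -- Step 1: differentiation under the integral sign on the height set `S = (s - 1, s + 1)`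
  set Φ : ℝ → EuclideanSpace ℝ (Fin n) → ℝ :=
    fun s' y => Real.smoothTransition (a + 1 - (√(1 + ‖y‖ ^ 2) + c * s')) * e s' y with hΦ
  have hSo : IsOpen (Ioo (s - 1) (s + 1)) := isOpen_Ioo
  have hsS : s ∈ Ioo (s - 1) (s + 1) := by constructor <;> linarith
  have hΦs : IsSmoothSpaceTimeOn (Ioo (s - 1) (s + 1)) Φ :=
    ((contDiff_cutoff_uncurry a c).mul he).contDiffOn
  set R : ℝ := a + 1 + |c| * (|s| + 1) with hR
  have hK : IsCompact (closedBall (0 : EuclideanSpace ℝ (Fin n)) R) := isCompact_closedBall _ _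
  have hsupp : ∀ s' ∈ Ioo (s - 1) (s + 1), ∀ y ∉ closedBall (0 : EuclideanSpace ℝ (Fin n)) R, Φ s' y = 0 := by
    intro s' hs' y hy
    rw [mem_closedBall, dist_zero_right, not_le] at hy
    have hs'1 : |s'| ≤ |s| + 1 := by
      have h1 := hs'.1
      have h2 := hs'.2
      rw [abs_le]
      constructor
      · linarith [neg_abs_le s]
      · linarith [le_abs_self s]
    have hcs : -(c * s') ≤ |c| * (|s| + 1) := by
      calc -(c * s') ≤ |c * s'| := neg_le_abs _
        _ = |c| * |s'| := abs_mul _ _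
        _ ≤ |c| * (|s| + 1) := mul_le_mul_of_nonneg_left hs'1 (abs_nonneg c)
    have h : a + 1 - c * s' < ‖y‖ := by linarith
    simp [hΦ, cutoff_eq_zero h]
  have key := hasDerivAt_integral_of_support_subset (μ := (volume : Measure (EuclideanSpace ℝ (Fin n))))
    hSo hΦs hK hsupp hsS
  -- Step 2: the height derivative of the integrand, with the balance law inserted ON THE CONE and `χ = χ' = 0` off it
  have hes : ∀ s', ContDiff ℝ ∞ (e s') := contDiff_slice he
  have hσs : ∀ s', ContDiff ℝ ∞ (σ s') := contDiff_slice hσ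
  have hfs : ∀ i s', ContDiff ℝ ∞ (f i s') := fun i => contDiff_slice (hf i)
  have hderiv : ∀ y, deriv (fun s' => Φ s' y) s =
      deriv (fun v : ℝ => Real.smoothTransition (a + 1 - v)) (√(1 + ‖y‖ ^ 2) + c * s) * c * e s y +
        Real.smoothTransition (a + 1 - (√(1 + ‖y‖ ^ 2) + c * s)) * σ s y -
        Real.smoothTransition (a + 1 - (√(1 + ‖y‖ ^ 2) + c * s)) *
          ∑ i, fderiv ℝ (f i s) y (EuclideanSpace.single i 1) := by
    intro y
    have het : HasDerivAt (fun s' => e s' y) (deriv (fun s' => e s' y) s) s :=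
      ((contDiff_line he y).differentiable (by simp) s).hasDerivAt
    have h := ((hasDerivAt_cutoff a c s y).fun_mul het).deriv
    simp only [hΦ]
    by_cases hy : √(1 + ‖y‖ ^ 2) + c * s ≤ a + 1
    · rw [h, eq_sub_of_add_eq (hbal y hy)]
      ring
    · push Not at hy
      rw [h, cutoff_eq_zero_of_lt hy, deriv_cutoff_eq_zero_of_lt hy]
      ring
  -- Step 3: integrability of the pieces (compact support in `y`)
  have hc1 : ∀ i, Continuous fun y : EuclideanSpace ℝ (Fin n) => fderiv ℝ (f i s) y (EuclideanSpace.single i 1) :=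
    fun i => ((hfs i s).continuous_fderiv (by simp)).clm_apply continuous_const
  have hc2 : ∀ i, Continuous fun y : EuclideanSpace ℝ (Fin n) => y i / √(1 + ‖y‖ ^ 2) * f i s y := fun i =>
    (((PiLp.proj (𝕜 := ℝ) 2 (fun _ : Fin n => ℝ) i).continuous.div
      (contDiff_bracket (k := 0)).continuous
      fun y => (bracket_pos y).ne')).mul (hfs i s).continuous
  have hce : Continuous fun y : EuclideanSpace ℝ (Fin n) => c * e s y := continuous_const.mul (hes s).continuous
  have hI1' : Integrable fun y : EuclideanSpace ℝ (Fin n) =>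
      deriv (fun v : ℝ => Real.smoothTransition (a + 1 - v)) (√(1 + ‖y‖ ^ 2) + c * s) * c * e s y := by
    refine (integrable_deriv_cutoff_mul a c s hce).congr (Eventually.of_forall fun y => ?_)
    simp only [mul_assoc]
  have hIσ : Integrable fun y : EuclideanSpace ℝ (Fin n) =>
      Real.smoothTransition (a + 1 - (√(1 + ‖y‖ ^ 2) + c * s)) * σ s y :=
    integrable_cutoff_mul a c s (hσs s).continuous
  have hI12 : Integrable fun y : EuclideanSpace ℝ (Fin n) =>
      deriv (fun v : ℝ => Real.smoothTransition (a + 1 - v)) (√(1 + ‖y‖ ^ 2) + c * s) * c * e s y +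
        Real.smoothTransition (a + 1 - (√(1 + ‖y‖ ^ 2) + c * s)) * σ s y := hI1'.add hIσ
  have hI2 : ∀ i, Integrable fun y : EuclideanSpace ℝ (Fin n) =>
      Real.smoothTransition (a + 1 - (√(1 + ‖y‖ ^ 2) + c * s)) *
        fderiv ℝ (f i s) y (EuclideanSpace.single i 1) := fun i =>
    integrable_cutoff_mul a c s (hc1 i)
  have hI3 : ∀ i, Integrable fun y : EuclideanSpace ℝ (Fin n) =>
      deriv (fun v : ℝ => Real.smoothTransition (a + 1 - v)) (√(1 + ‖y‖ ^ 2) + c * s) *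
        (y i / √(1 + ‖y‖ ^ 2) * f i s y) := fun i =>
    integrable_deriv_cutoff_mul a c s (hc2 i)
  -- Step 4: integration by parts in each spatial direction
  have hibp : ∀ i, ∫ y : EuclideanSpace ℝ (Fin n), Real.smoothTransition (a + 1 - (√(1 + ‖y‖ ^ 2) + c * s)) *
      fderiv ℝ (f i s) y (EuclideanSpace.single i 1) =
      -∫ y : EuclideanSpace ℝ (Fin n), deriv (fun v : ℝ => Real.smoothTransition (a + 1 - v)) (√(1 + ‖y‖ ^ 2) + c * s) *
        (y i / √(1 + ‖y‖ ^ 2) * f i s y) := by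
    intro i
    rw [integral_mul_fderiv_eq_neg_of_hasCompactSupport (contDiff_cutoff a c s) (hasCompactSupport_cutoff a c s)
      ((hfs i s).of_le (by exact_mod_cast le_top)) (EuclideanSpace.single i 1)]
    congr 1
    refine integral_congr_ae (Eventually.of_forall fun y => ?_)
    simp only [fderiv_cutoff_single]
    ring
  -- Step 5: assemble
  refine key.congr_deriv ?_
  calc ∫ y : EuclideanSpace ℝ (Fin n), deriv (fun s' => Φ s' y) s
      = ∫ y : EuclideanSpace ℝ (Fin n),
          ((deriv (fun v : ℝ => Real.smoothTransition (a + 1 - v)) (√(1 + ‖y‖ ^ 2) + c * s) * c * e s y +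
            Real.smoothTransition (a + 1 - (√(1 + ‖y‖ ^ 2) + c * s)) * σ s y) -
          ∑ i, Real.smoothTransition (a + 1 - (√(1 + ‖y‖ ^ 2) + c * s)) *
            fderiv ℝ (f i s) y (EuclideanSpace.single i 1)) := by
        refine integral_congr_ae (Eventually.of_forall fun y => ?_)
        simp only [hderiv, Finset.mul_sum]
    _ = ((∫ y : EuclideanSpace ℝ (Fin n),
            deriv (fun v : ℝ => Real.smoothTransition (a + 1 - v)) (√(1 + ‖y‖ ^ 2) + c * s) * c * e s y) +
          ∫ y : EuclideanSpace ℝ (Fin n), Real.smoothTransition (a + 1 - (√(1 + ‖y‖ ^ 2) + c * s)) * σ s y) -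
          ∑ i, ∫ y : EuclideanSpace ℝ (Fin n), Real.smoothTransition (a + 1 - (√(1 + ‖y‖ ^ 2) + c * s)) *
            fderiv ℝ (f i s) y (EuclideanSpace.single i 1) := by
        rw [integral_sub hI12 (integrable_finsetSum _ fun i _ => hI2 i),
          integral_add hI1' hIσ, integral_finsetSum _ fun i _ => hI2 i]
    _ = ((∫ y : EuclideanSpace ℝ (Fin n),
            deriv (fun v : ℝ => Real.smoothTransition (a + 1 - v)) (√(1 + ‖y‖ ^ 2) + c * s) * c * e s y) +
          ∑ i, ∫ y : EuclideanSpace ℝ (Fin n), deriv (fun v : ℝ => Real.smoothTransition (a + 1 - v)) (√(1 + ‖y‖ ^ 2) + c * s) *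
            (y i / √(1 + ‖y‖ ^ 2) * f i s y)) +
          ∫ y : EuclideanSpace ℝ (Fin n), Real.smoothTransition (a + 1 - (√(1 + ‖y‖ ^ 2) + c * s)) * σ s y := by
        simp only [hibp, Finset.sum_neg_distrib, sub_neg_eq_add]
        ring
    _ = (∫ y : EuclideanSpace ℝ (Fin n),
            (deriv (fun v : ℝ => Real.smoothTransition (a + 1 - v)) (√(1 + ‖y‖ ^ 2) + c * s) * c * e s y +
              ∑ i, deriv (fun v : ℝ => Real.smoothTransition (a + 1 - v)) (√(1 + ‖y‖ ^ 2) + c * s) *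
                (y i / √(1 + ‖y‖ ^ 2) * f i s y))) +
          ∫ y : EuclideanSpace ℝ (Fin n), Real.smoothTransition (a + 1 - (√(1 + ‖y‖ ^ 2) + c * s)) * σ s y := by
        rw [integral_add hI1' (integrable_finsetSum _ fun i _ => hI3 i),
          integral_finsetSum _ fun i _ => hI3 i]
    _ = _ := by
        congr 1
        refine integral_congr_ae (Eventually.of_forall fun y => ?_)
        have hb := (bracket_pos y).ne'
        simp only [Finset.mul_sum, mul_add]
        congr 1
        · field_simp
        · exact Finset.sum_congr rfl fun i _ => by field_simp

/-- **The local energy inequality (differential form), cone-local hypotheses.**  Balance law and flux dominance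
`0 ≤ c⟨y⟩ e + Σᵢ yᵢ fᵢ` assumed at the points `(s, y)` with `⟨y⟩ + cs ≤ a + 1` only: `M'(s) ≤ ∫ χ_a(⟨y⟩ + cs) σ(s, y) dy`.
[folklore] -/
theorem deriv_coneEnergy_le_local (he : ContDiff ℝ ∞ (uncurry e)) (hf : ∀ i, ContDiff ℝ ∞ (uncurry (f i)))
    (hσ : ContDiff ℝ ∞ (uncurry σ)) (a c : ℝ) {s : ℝ}
    (hbal : ∀ y : EuclideanSpace ℝ (Fin n), √(1 + ‖y‖ ^ 2) + c * s ≤ a + 1 →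
      deriv (fun s' => e s' y) s + ∑ i, fderiv ℝ (f i s) y (EuclideanSpace.single i 1) = σ s y)
    (hflux : ∀ y : EuclideanSpace ℝ (Fin n), √(1 + ‖y‖ ^ 2) + c * s ≤ a + 1 →
      0 ≤ c * √(1 + ‖y‖ ^ 2) * e s y + ∑ i, y i * f i s y) :
    deriv (fun s' => ∫ y : EuclideanSpace ℝ (Fin n),
        Real.smoothTransition (a + 1 - (√(1 + ‖y‖ ^ 2) + c * s')) * e s' y) s ≤
      ∫ y : EuclideanSpace ℝ (Fin n), Real.smoothTransition (a + 1 - (√(1 + ‖y‖ ^ 2) + c * s)) * σ s y := by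
  rw [(hasDerivAt_coneEnergy_local he hf hσ a c s hbal).deriv]
  have h0 : ∫ y : EuclideanSpace ℝ (Fin n),
      deriv (fun v : ℝ => Real.smoothTransition (a + 1 - v)) (√(1 + ‖y‖ ^ 2) + c * s) / √(1 + ‖y‖ ^ 2) *
        (c * √(1 + ‖y‖ ^ 2) * e s y + ∑ i, y i * f i s y) ≤ 0 := by
    refine integral_nonpos fun y => ?_
    by_cases hy : √(1 + ‖y‖ ^ 2) + c * s ≤ a + 1
    · have h1 := deriv_profile_nonpos (a + 1) (√(1 + ‖y‖ ^ 2) + c * s)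
      have h2 := bracket_pos y
      exact mul_nonpos_iff.2 (Or.inr ⟨div_nonpos_iff.2 (Or.inr ⟨h1, h2.le⟩), hflux y hy⟩)
    · push Not at hy
      simp [deriv_cutoff_eq_zero_of_lt hy]
  linarith

/-- **The local energy inequality (Grönwall form), cone-local hypotheses on the height interval `[t₀, t]`.**  Balance law, flux dominance
and the source bound `σ ≤ K e` assumed only at the points `(s, y)` with `t₀ ≤ s ≤ t` and `⟨y⟩ + cs ≤ a + 1`:
`M(t) ≤ exp(K (t − t₀)) · M(t₀)`. [folklore] -/
theorem coneEnergy_le_exp_mul_local (he : ContDiff ℝ ∞ (uncurry e)) (hf : ∀ i, ContDiff ℝ ∞ (uncurry (f i)))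
    (hσ : ContDiff ℝ ∞ (uncurry σ)) (a c : ℝ) {t₀ K t : ℝ} (ht : t₀ ≤ t)
    (hbal : ∀ s ∈ Icc t₀ t, ∀ y : EuclideanSpace ℝ (Fin n), √(1 + ‖y‖ ^ 2) + c * s ≤ a + 1 →
      deriv (fun s' => e s' y) s + ∑ i, fderiv ℝ (f i s) y (EuclideanSpace.single i 1) = σ s y)
    (hflux : ∀ s ∈ Icc t₀ t, ∀ y : EuclideanSpace ℝ (Fin n), √(1 + ‖y‖ ^ 2) + c * s ≤ a + 1 →
      0 ≤ c * √(1 + ‖y‖ ^ 2) * e s y + ∑ i, y i * f i s y)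
    (hsrc : ∀ s ∈ Icc t₀ t, ∀ y : EuclideanSpace ℝ (Fin n), √(1 + ‖y‖ ^ 2) + c * s ≤ a + 1 → σ s y ≤ K * e s y) :
    ∫ y : EuclideanSpace ℝ (Fin n), Real.smoothTransition (a + 1 - (√(1 + ‖y‖ ^ 2) + c * t)) * e t y ≤
      Real.exp (K * (t - t₀)) *
        ∫ y : EuclideanSpace ℝ (Fin n), Real.smoothTransition (a + 1 - (√(1 + ‖y‖ ^ 2) + c * t₀)) * e t₀ y := by
  set M : ℝ → ℝ := fun s' => ∫ y : EuclideanSpace ℝ (Fin n),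
    Real.smoothTransition (a + 1 - (√(1 + ‖y‖ ^ 2) + c * s')) * e s' y with hM
  have hd : ∀ s' ∈ Icc t₀ t, HasDerivAt M (deriv M s') s' := fun s' hs' =>
    (hasDerivAt_coneEnergy_local he hf hσ a c s' (hbal s' hs')).differentiableAt.hasDerivAt
  have hes : ∀ s', ContDiff ℝ ∞ (e s') := contDiff_slice he
  have hσs : ∀ s', ContDiff ℝ ∞ (σ s') := contDiff_slice hσ
  -- `M' ≤ K M` on `[t₀, t]`
  have hM' : ∀ s' ∈ Icc t₀ t, deriv M s' ≤ K * M s' := by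
    intro s' hs'
    have h1 := deriv_coneEnergy_le_local he hf hσ a c (hbal s' hs') (hflux s' hs')
    have h2 : ∫ y : EuclideanSpace ℝ (Fin n), Real.smoothTransition (a + 1 - (√(1 + ‖y‖ ^ 2) + c * s')) * σ s' y ≤
        ∫ y : EuclideanSpace ℝ (Fin n), K * (Real.smoothTransition (a + 1 - (√(1 + ‖y‖ ^ 2) + c * s')) * e s' y) := by
      refine integral_mono (integrable_cutoff_mul a c s' (hσs s').continuous)
        ((integrable_cutoff_mul a c s' (hes s').continuous).const_mul K) fun y => ?_
      by_cases hy : √(1 + ‖y‖ ^ 2) + c * s' ≤ a + 1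
      · have := mul_le_mul_of_nonneg_left (hsrc s' hs' y hy)
          (Real.smoothTransition.nonneg (a + 1 - (√(1 + ‖y‖ ^ 2) + c * s')))
        simpa only [mul_left_comm] using this
      · push Not at hy
        simp [cutoff_eq_zero_of_lt hy]
    rw [integral_const_mul] at h2
    exact h1.trans h2
  -- `g(s) = exp(-K s) M(s)` is non-increasing on `[t₀, t]`
  set g : ℝ → ℝ := fun s' => Real.exp (-K * s') * M s' with hg
  have hgd : ∀ s' ∈ Icc t₀ t,
      HasDerivAt g (Real.exp (-K * s') * (-K) * M s' + Real.exp (-K * s') * deriv M s') s' := by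
    intro s' hs'
    have h1 : HasDerivAt (fun s' => Real.exp (-K * s')) (Real.exp (-K * s') * (-K)) s' := by
      simpa using ((hasDerivAt_id s').const_mul (-K)).exp
    exact h1.mul (hd s' hs')
  have hanti : AntitoneOn g (Icc t₀ t) := by
    refine antitoneOn_of_deriv_nonpos (convex_Icc t₀ t) (fun s' hs' => (hgd s' hs').continuousAt.continuousWithinAt)
      (fun s' hs' => (hgd s' (interior_subset hs')).differentiableAt.differentiableWithinAt) fun s' hs' => ?_
    have hs'I : s' ∈ Icc t₀ t := interior_subset hs'
    rw [(hgd s' hs'I).deriv]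
    have hE : 0 < Real.exp (-K * s') := Real.exp_pos _
    have := hM' s' hs'I
    nlinarith
  have hgt := hanti (left_mem_Icc.2 ht) (right_mem_Icc.2 ht) ht
  -- unfold and rearrange
  simp only [hg] at hgt
  have hE0 : 0 < Real.exp (-K * t) := Real.exp_pos _
  have hexp : Real.exp (K * (t - t₀)) * Real.exp (-K * t) = Real.exp (-K * t₀) := by
    rw [← Real.exp_add]
    congr 1
    ring
  have : M t * Real.exp (-K * t) ≤ (Real.exp (K * (t - t₀)) * M t₀) * Real.exp (-K * t) := by
    rw [mul_assoc, mul_comm (M t₀), ← mul_assoc, hexp]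
    linarith
  exact le_of_mul_le_mul_right this hE0

/-- From the user-friendly cone region to the cutoff region: `⟨y⟩ + cs ≤ √(1+ρ²) + ct + 1` implies
`‖y‖ ≤ √(1+ρ²) + c(t − s) + 1`. [folklore] -/
theorem norm_le_of_bracket_cone {ρ c t s : ℝ} {y : EuclideanSpace ℝ (Fin n)}
    (hy : √(1 + ‖y‖ ^ 2) + c * s ≤ √(1 + ρ ^ 2) + c * t + 1) : ‖y‖ ≤ √(1 + ρ ^ 2) + c * (t - s) + 1 := by
  have := norm_le_bracket y
  linarith

/-- **Domain of dependence at speed `c` (ball form), hypotheses on the truncated solid cone only.**  Let `e, fᵢ, σ` be jointly smooth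
on `ℝ × ℝⁿ`.  Assume, ONLY at the points `(s, y)` with `t₀ ≤ s ≤ t` and `‖y‖ ≤ √(1+ρ²) + c(t − s) + 1`: the balance law
`∂ₛe + Σᵢ ∂ᵢfᵢ = σ`, `0 ≤ e`, flux dominance `0 ≤ c⟨y⟩e + Σᵢ yᵢfᵢ` and `σ ≤ K e`.  Then
`∫_{|y| ≤ ρ} e(t, y) dy ≤ exp(K(t − t₀)) ∫_{|y| ≤ √(1+ρ²) + c(t−t₀) + 1} e(t₀, y) dy`. [folklore] -/
theorem setIntegral_closedBall_le_exp_mul_local (he : ContDiff ℝ ∞ (uncurry e)) (hf : ∀ i, ContDiff ℝ ∞ (uncurry (f i)))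
    (hσ : ContDiff ℝ ∞ (uncurry σ)) {c t₀ K t : ℝ} (ht : t₀ ≤ t) (ρ : ℝ)
    (hbal : ∀ s ∈ Icc t₀ t, ∀ y : EuclideanSpace ℝ (Fin n), ‖y‖ ≤ √(1 + ρ ^ 2) + c * (t - s) + 1 →
      deriv (fun s' => e s' y) s + ∑ i, fderiv ℝ (f i s) y (EuclideanSpace.single i 1) = σ s y)
    (hpos : ∀ s ∈ Icc t₀ t, ∀ y : EuclideanSpace ℝ (Fin n), ‖y‖ ≤ √(1 + ρ ^ 2) + c * (t - s) + 1 → 0 ≤ e s y)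
    (hflux : ∀ s ∈ Icc t₀ t, ∀ y : EuclideanSpace ℝ (Fin n), ‖y‖ ≤ √(1 + ρ ^ 2) + c * (t - s) + 1 →
      0 ≤ c * √(1 + ‖y‖ ^ 2) * e s y + ∑ i, y i * f i s y)
    (hsrc : ∀ s ∈ Icc t₀ t, ∀ y : EuclideanSpace ℝ (Fin n), ‖y‖ ≤ √(1 + ρ ^ 2) + c * (t - s) + 1 →
      σ s y ≤ K * e s y) :
    ∫ y in closedBall (0 : EuclideanSpace ℝ (Fin n)) ρ, e t y ≤
      Real.exp (K * (t - t₀)) *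
        ∫ y in closedBall (0 : EuclideanSpace ℝ (Fin n)) (√(1 + ρ ^ 2) + c * (t - t₀) + 1), e t₀ y := by
  set a : ℝ := √(1 + ρ ^ 2) + c * t with ha
  have hes : ∀ s', ContDiff ℝ ∞ (e s') := contDiff_slice he
  -- the cutoff region lies inside the user-friendly cone region
  have hreg : ∀ s (y : EuclideanSpace ℝ (Fin n)), √(1 + ‖y‖ ^ 2) + c * s ≤ a + 1 →
      ‖y‖ ≤ √(1 + ρ ^ 2) + c * (t - s) + 1 := by
    intro s y hy
    rw [ha] at hy
    exact norm_le_of_bracket_cone hy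
  have hgr := coneEnergy_le_exp_mul_local he hf hσ a c ht
    (fun s hs y hy => hbal s hs y (hreg s y hy)) (fun s hs y hy => hflux s hs y (hreg s y hy))
    (fun s hs y hy => hsrc s hs y (hreg s y hy))
  -- at height `t` the cutoff is `1` on the ball of radius `ρ`, and `χ e ≥ 0` everywhere
  have hnn : ∀ y : EuclideanSpace ℝ (Fin n), 0 ≤ Real.smoothTransition (a + 1 - (√(1 + ‖y‖ ^ 2) + c * t)) * e t y := by
    intro y
    by_cases hy : √(1 + ‖y‖ ^ 2) + c * t ≤ a + 1
    · exact mul_nonneg (Real.smoothTransition.nonneg _) (hpos t (right_mem_Icc.2 ht) y (hreg t y hy))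
    · push Not at hy
      simp [cutoff_eq_zero_of_lt hy]
  have h3 : ∫ y in closedBall (0 : EuclideanSpace ℝ (Fin n)) ρ, e t y ≤
      ∫ y : EuclideanSpace ℝ (Fin n), Real.smoothTransition (a + 1 - (√(1 + ‖y‖ ^ 2) + c * t)) * e t y := by
    calc ∫ y in closedBall (0 : EuclideanSpace ℝ (Fin n)) ρ, e t y
        = ∫ y in closedBall (0 : EuclideanSpace ℝ (Fin n)) ρ,
            Real.smoothTransition (a + 1 - (√(1 + ‖y‖ ^ 2) + c * t)) * e t y := by
          refine setIntegral_congr_fun measurableSet_closedBall fun y hy => ?_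
          rw [mem_closedBall, dist_zero_right] at hy
          have hy2 : ‖y‖ ^ 2 ≤ ρ ^ 2 := by nlinarith [norm_nonneg y]
          have hle : √(1 + ‖y‖ ^ 2) + c * t ≤ a := by
            rw [ha]
            gcongr
          simp only [cutoff_eq_one hle, one_mul]
      _ ≤ ∫ y : EuclideanSpace ℝ (Fin n), Real.smoothTransition (a + 1 - (√(1 + ‖y‖ ^ 2) + c * t)) * e t y :=
          setIntegral_le_integral (integrable_cutoff_mul a c t (hes t).continuous) (Eventually.of_forall hnn)
  -- at height `t₀` the cutoff is `≤ 1` and vanishes outside the ball of radius `a + 1 - c t₀`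
  have hR : a + 1 - c * t₀ = √(1 + ρ ^ 2) + c * (t - t₀) + 1 := by rw [ha]; ring
  have h4 : ∫ y : EuclideanSpace ℝ (Fin n), Real.smoothTransition (a + 1 - (√(1 + ‖y‖ ^ 2) + c * t₀)) * e t₀ y ≤
      ∫ y in closedBall (0 : EuclideanSpace ℝ (Fin n)) (√(1 + ρ ^ 2) + c * (t - t₀) + 1), e t₀ y := by
    have hzero : ∀ y ∉ closedBall (0 : EuclideanSpace ℝ (Fin n)) (√(1 + ρ ^ 2) + c * (t - t₀) + 1),
        Real.smoothTransition (a + 1 - (√(1 + ‖y‖ ^ 2) + c * t₀)) * e t₀ y = 0 := by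
      intro y hy
      rw [mem_closedBall, dist_zero_right, not_le, ← hR] at hy
      simp [cutoff_eq_zero hy]
    rw [← setIntegral_eq_integral_of_forall_compl_eq_zero hzero]
    refine setIntegral_mono_on (integrable_cutoff_mul a c t₀ (hes t₀).continuous).integrableOn
      ((hes t₀).continuous.continuousOn.integrableOn_compact (isCompact_closedBall _ _))
      measurableSet_closedBall fun y hy => ?_
    rw [mem_closedBall, dist_zero_right] at hy
    exact mul_le_of_le_one_left (hpos t₀ (left_mem_Icc.2 ht) y hy) (Real.smoothTransition.le_one _)
  have hE : 0 ≤ Real.exp (K * (t - t₀)) := (Real.exp_pos _).le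
  calc ∫ y in closedBall (0 : EuclideanSpace ℝ (Fin n)) ρ, e t y
      ≤ ∫ y : EuclideanSpace ℝ (Fin n), Real.smoothTransition (a + 1 - (√(1 + ‖y‖ ^ 2) + c * t)) * e t y := h3
    _ ≤ Real.exp (K * (t - t₀)) *
        ∫ y : EuclideanSpace ℝ (Fin n), Real.smoothTransition (a + 1 - (√(1 + ‖y‖ ^ 2) + c * t₀)) * e t₀ y := hgr
    _ ≤ Real.exp (K * (t - t₀)) *
        ∫ y in closedBall (0 : EuclideanSpace ℝ (Fin n)) (√(1 + ρ ^ 2) + c * (t - t₀) + 1), e t₀ y :=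
        mul_le_mul_of_nonneg_left h4 hE

end ConeEnergy

end Summit.NavierStokesRegularity.NavierStokesRegularity.Theorems.PoloidalWindowDoorPoloidalWindowRigidityZShockLocalEnergyLocal

end
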